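import Mathlib
import HarnessLib
import Summits.NavierStokesRegularity.NavierStokesRegularity.Theorems.TaylorModelRungThreeVReadoutsWinDefs

/-!
# Line `taylor-model` on crux K1b-DR (stmt-NavierStokesRegularity-23954) — v3 (VECTOR STEP) semantic interface, part 3-WP:
# the windowed read-outs with the POINCARÉ-CORRECTED base landing `ReadoutsVP`, `ValidVP` (ns-tm-g4 g6, read-out layer owner)

Definitions-only successor of `…VReadoutsWinDefs` (`ReadoutsVW`).  WHY: the first windowed replays (engine-1 j321721/j322168) show
that the level-0 objects of `ReadoutsVW` — the in-step box of the WHOLE level-0 hull `H⁰ = x_{S−1} ± |B|·rp` over the level-0 window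
— cannot pass on real data: a validated enclosure is a needle ALONG THE FLOW, its box has a time-extent `δt ≈ 1–3·10⁻¹¹` on the
self-similar stages (`≈ 1.6·10⁻¹⁰` at stage 0), and the base landing read on a box smears by `rate_j·δt` with `rate_j = 2.4·10⁹…
2.4·10¹²` polytope radii per unit time — above the loop's `2.8 %` level-0 margin.  `ReadoutsVP` reads the base landing THROUGH THE
SECTION (Poincaré map), whose derivative `Dland·Psec·DΦ` annihilates the flow direction:

* the level-0 window `[ulo 0, uhi 0]` and box `[zlo 0, zhi 0]` of `WinData` now belong to the CENTRE TRAJECTORY ALONE (the Taylor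
  polynomial `TP` of `x_{S−1}` plus its remainder `r`, a point trajectory — clauses (Wc2)–(Wc4));
* **(R9p)**: for the centre's crossing state `yc ∈ Z⁰c ∩ {σf = lev}`, every crossing state `y₁ ∈ Z¹ ∩ {σf = lev}`, every in-step
  kernel `A` at a time of the level-1 window and every point `y₀` of the level-0 hull at node `S−1`:
  `|ℓ(land yc v) − ctr| + |ℓ(landD y₁ v (secCorr y₁ (kapp A (y₀ − x (S−1)))))| + β ≤ rad − s`
  — the G-side applies the mean value theorem to `s ↦ ℓ(land(P(x + s(y* − x))))` along the segment from the centre `x = x_{S−1}` to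
  the true base state `y* ∈ H⁰` (a `NodeStart 0` segment ⊆ H⁰ ⊆ H¹): its derivative is the second term (Poincaré C¹ theorem as in
  `landingDeriv_ofVW`, crossing of every segment point located in the LEVEL-1 window by (W2p)/(W3p)), `g(0)` the first;
* (R0)–(R7), (R8w), (R10w), (R11w), (W1) VERBATIM at the positions of `ReadoutsVW`; (W2p)–(W4p) = (W2)–(W4) at level 1 only.
* `ValidVP cd bx rd ro rw := cd.Static ∧ cd.StageNumerics ∧ ChainV cd bx rd ∧ ReadoutsVP cd bx rd ro rw`.

Kernel: `readoutStepWinP` (`…CertificateReadoutVStepWinP`); measurement of the (R9p) numbers: `…ReadoutVDiagWinP` (p687266).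
MODEL-lattice rung TL-M3 only; nothing here is a statement about the Navier–Stokes equations, and nothing is asserted.
-/

noncomputable section

-- the sub-problem namespace repeats the summit name by design (D-0017)
set_option linter.dupNamespace false

namespace Summit.NavierStokesRegularity.NavierStokesRegularity.Theorems.TaylorModelV

open Set Literature.Analysis.FluidPDE.TaoCascade Literature.Analysis.FluidPDE.TaoCascade.TaylorChain
open Summit.NavierStokesRegularity.NavierStokesRegularity.Theorems.TaylorModelReadout

/-- **(TM-V windowed read-outs, Poincaré-corrected base landing)** — clause list in the module docstring. [folklore] -/
def ReadoutsVP (cd : CertData) (bx : StepBoxes) (rd : RadiiData) (ro : ReadoutData) (rw : WinData) : Prop :=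
  ∀ j, j ≤ cd.N₀ →
    -- (R0) stage scalars, the base point, and the section functional reads the window only
    cd.Tn j (cd.S j) ≤ cd.τs ∧ InPoly cd j (cd.x j 0) ∧ 0 < cd.γ j ∧ 0 ≤ ro.ΛT j ∧
    (∀ y : Fin 4 → ℤ → ℝ, cd.σf j y = cd.σf j (trunc cd y)) ∧
    -- (R1) TUBE HULL: the level-1 hull inflated by `ΛT·κ·ω` lies in the outer hull, at every node
    (∀ s', s' ≤ cd.S j → ∀ y d : Fin 4 → ℤ → ℝ, InBox cd (bx.hlo 1 j s') (bx.hhi 1 j s') y →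
      cd.InBall j d (ro.ΛT j * cd.κ j) → InBox cd (bx.hlo 2 j s') (bx.hhi 2 j s') (y + d)) ∧
    -- (R2) TUBE GROWTH over every chain of real one-step kernels
    (∀ s₀ s₁, s₀ ≤ s₁ → s₁ ≤ cd.S j → ∀ A : ℕ → Ker,
      (∀ s', s₀ ≤ s' → s' < s₁ → KerMem cd (A s') (bx.Mlo j s') (bx.Mhi j s')) →
      ∀ (v : Fin 4 → ℤ → ℝ) (r : ℝ), 0 ≤ r → cd.InBall j v r →
        cd.InBall j (kiter cd A s₀ (s₁ - s₀) v) (ro.G j s₀ s₁ * r)) ∧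
    -- (R3) K1b-DR's `Λ` and the hull multiple `ΛT` from the forward factors `L1` and `G`
    (∀ a b, a < cd.S j → a + 1 ≤ b → b ≤ cd.S j →
      cd.L1 j a * ro.G j (a + 1) b ≤ ro.ΛT j ∧ (b < cd.S j → cd.L1 j a * ro.G j (a + 1) b * cd.L1 j b ≤ cd.Λ j)) ∧
    (∀ a, a < cd.S j → cd.L1 j a ≤ cd.Λ j) ∧
    -- (R4) window M-bounds per sub-step
    (∀ s', s' < cd.S j → ∀ i k, -cd.Kb ≤ k → k ≤ cd.Ka →
      -cd.M k ≤ bx.lo j s' i k + bx.loK j s' i k ∧ bx.hi j s' i k + bx.hiK j s' i k ≤ cd.M k ∧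
      -(cd.M k - cd.Λ j * cd.δ j * cd.τs * cd.ω j k - cd.mm) ≤ bx.lo j s' i k ∧
      bx.hi j s' i k ≤ cd.M k - cd.Λ j * cd.δ j * cd.τs * cd.ω j k - cd.mm) ∧
    -- (R5) section: before at node `S−1`, after at node `S` (level-1 hulls)
    (∀ y, InBox cd (bx.hlo 1 j (cd.S j - 1)) (bx.hhi 1 j (cd.S j - 1)) y → cd.σf j y < cd.lev j) ∧
    (∀ y, InBox cd (bx.hlo 1 j (cd.S j)) (bx.hhi 1 j (cd.S j)) y → cd.lev j < cd.σf j y) ∧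
    -- (R6) in-step boxes over the last sub-step (levels 0 and 1)
    (∀ l : Fin 2, ∀ u ∈ Icc 0 (cd.h j (cd.S j - 1)), ∀ A : Ker, InStepKer cd bx j (cd.S j - 1) u A →
      ∀ y, InBox cd (bx.hlo (hullLevel l) j (cd.S j - 1)) (bx.hhi (hullLevel l) j (cd.S j - 1)) y →
      ∀ r : Fin 4 → ℤ → ℝ, AbsLeW cd r (fun i k => bx.J j (cd.S j - 1) i k * u ^ (cd.pdeg + 1)) →
        InBox cd (ro.ylo l j) (ro.yhi l j) (cd.TP j (cd.S j - 1) u + r + kapp cd A (y - cd.x j (cd.S j - 1)))) ∧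
    -- (R7) transversality on the level-1 in-step box
    (∀ y, InBox cd (ro.ylo 1 j) (ro.yhi 1 j) y → cd.γ j ≤ cd.σf j (cd.Qb y y)) ∧
    -- (R8w) crossing read-outs on the WINDOWED level-1 box `Z¹ ∩ {σf = lev}`
    (∀ y, InBox cd (rw.zlo 1 j) (rw.zhi 1 j) y → cd.σf j y = cd.lev j →
      cd.as j ≤ |y cd.i₀ 1| ∧
      ∀ i, |y i (-cd.Kb)| + cd.Λ j * cd.δ j * cd.τs * cd.ω j (-cd.Kb) ≤
        (2:ℝ) ^ (-cd.θ) * (cd.Cb * (2:ℝ) ^ ((3:ℝ) / 4 * ((cd.Kb:ℝ) + 1)))) ∧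
    -- (R9p) POINCARÉ-CORRECTED base landing: the CENTRE trajectory's crossing state `yc ∈ Z⁰c ∩ {σf = lev}` (a point trajectory),
    -- plus a mean-value term through the section: for every crossing state `y₁ ∈ Z¹ ∩ {σf = lev}`, in-step kernel `A` at a time of the
    -- level-1 window and level-0 hull point `y₀` (displacement `y₀ − x (S−1)`), the section-corrected landing derivative is accounted
    (∀ yc, InBox cd (rw.zlo 0 j) (rw.zhi 0 j) yc → cd.σf j yc = cd.lev j →
      ∀ y₁, InBox cd (rw.zlo 1 j) (rw.zhi 1 j) y₁ → cd.σf j y₁ = cd.lev j →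
      ∀ u ∈ Icc (rw.ulo 1 j) (rw.uhi 1 j), ∀ A : Ker, InStepKer cd bx j (cd.S j - 1) u A →
      ∀ y₀, InBox cd (bx.hlo 0 j (cd.S j - 1)) (bx.hhi 0 j (cd.S j - 1)) y₀ → ∀ v, TailOK cd v → ∀ l,
      |cd.ℓ (cd.nx j) l (cd.land j yc v) - cd.ctr (cd.nx j) l| +
        |cd.ℓ (cd.nx j) l (cd.landD j y₁ v (secCorr cd j y₁ (kapp cd A (y₀ - cd.x j (cd.S j - 1)))))| +
        cd.β j l ≤ cd.rad (cd.nx j) l - cd.s (cd.nx j) l) ∧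
    -- (R10w) derivative kernel over the LEVEL-1 WINDOW: in-step kernel ∘ (Vc + Cm·[Z]) ∈ [Vlo, Vhi]
    (∀ u ∈ Icc (rw.ulo 1 j) (rw.uhi 1 j), ∀ A : Ker, InStepKer cd bx j (cd.S j - 1) u A →
      ∀ W : Ker, KerMem cd W (rd.Zlo j (cd.S j - 1)) (rd.Zhi j (cd.S j - 1)) →
        KerMem cd (kerOf fun v => kapp cd A (rd.Vc j (cd.S j - 1) v + cd.Cm j (cd.S j - 1) (kapp cd W v)))
          (ro.Vlo j) (ro.Vhi j)) ∧
    -- (R11w) landing derivative bound on the WINDOWED level-1 box (face-wise on the K-side)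
    (∀ y, InBox cd (rw.zlo 1 j) (rw.zhi 1 j) y → cd.σf j y = cd.lev j →
      ∀ V : Ker, KerMem cd V (ro.Vlo j) (ro.Vhi j) →
      ∀ q ζ : Fin 4 → ℤ → ℝ, InPoly cd j q → (∀ i k, -cd.Kb ≤ k → k ≤ cd.Ka → q i k = (cd.x j 0 + rd.Dsc j ζ) i k) →
      ∀ v, TailOK cd v → ∀ l,
        |cd.ℓ (cd.nx j) l (cd.landD j y v (secCorr cd j y (kapp cd V ζ)))| ≤ cd.β j l) ∧
    -- (W1) window order inside the last sub-step
    (0 ≤ rw.ulo 1 j ∧ rw.ulo 1 j ≤ rw.ulo 0 j ∧ rw.ulo 0 j ≤ rw.uhi 0 j ∧ rw.uhi 0 j ≤ rw.uhi 1 j ∧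
      rw.uhi 1 j ≤ cd.h j (cd.S j - 1)) ∧
    -- (W2p) LEVEL-1 window-end section BEFORE: every in-step state of a level-1 hull start at `u = ulo 1` has `σf < lev`
    (∀ A : Ker, InStepKer cd bx j (cd.S j - 1) (rw.ulo 1 j) A →
      ∀ y, InBox cd (bx.hlo 1 j (cd.S j - 1)) (bx.hhi 1 j (cd.S j - 1)) y →
      ∀ r : Fin 4 → ℤ → ℝ, AbsLeW cd r (fun i k => bx.J j (cd.S j - 1) i k * rw.ulo 1 j ^ (cd.pdeg + 1)) →
        cd.σf j (cd.TP j (cd.S j - 1) (rw.ulo 1 j) + r + kapp cd A (y - cd.x j (cd.S j - 1))) < cd.lev j) ∧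
    -- (W3p) LEVEL-1 window-end section AFTER at `u = uhi 1`
    (∀ A : Ker, InStepKer cd bx j (cd.S j - 1) (rw.uhi 1 j) A →
      ∀ y, InBox cd (bx.hlo 1 j (cd.S j - 1)) (bx.hhi 1 j (cd.S j - 1)) y →
      ∀ r : Fin 4 → ℤ → ℝ, AbsLeW cd r (fun i k => bx.J j (cd.S j - 1) i k * rw.uhi 1 j ^ (cd.pdeg + 1)) →
        cd.lev j < cd.σf j (cd.TP j (cd.S j - 1) (rw.uhi 1 j) + r + kapp cd A (y - cd.x j (cd.S j - 1)))) ∧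
    -- (W4p) LEVEL-1 WINDOWED in-step box
    (∀ u ∈ Icc (rw.ulo 1 j) (rw.uhi 1 j), ∀ A : Ker, InStepKer cd bx j (cd.S j - 1) u A →
      ∀ y, InBox cd (bx.hlo 1 j (cd.S j - 1)) (bx.hhi 1 j (cd.S j - 1)) y →
      ∀ r : Fin 4 → ℤ → ℝ, AbsLeW cd r (fun i k => bx.J j (cd.S j - 1) i k * u ^ (cd.pdeg + 1)) →
        InBox cd (rw.zlo 1 j) (rw.zhi 1 j) (cd.TP j (cd.S j - 1) u + r + kapp cd A (y - cd.x j (cd.S j - 1)))) ∧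
    -- (Wc2) CENTRE window-end BEFORE: the centre polynomial's states (Taylor remainder `r`) at `u = ulo 0` have `σf < lev`
    (∀ r : Fin 4 → ℤ → ℝ, AbsLeW cd r (fun i k => bx.J j (cd.S j - 1) i k * rw.ulo 0 j ^ (cd.pdeg + 1)) →
      cd.σf j (cd.TP j (cd.S j - 1) (rw.ulo 0 j) + r) < cd.lev j) ∧
    -- (Wc3) CENTRE window-end AFTER at `u = uhi 0`
    (∀ r : Fin 4 → ℤ → ℝ, AbsLeW cd r (fun i k => bx.J j (cd.S j - 1) i k * rw.uhi 0 j ^ (cd.pdeg + 1)) →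
      cd.lev j < cd.σf j (cd.TP j (cd.S j - 1) (rw.uhi 0 j) + r)) ∧
    -- (Wc4) CENTRE-ONLY windowed box `Z⁰c = [zlo 0, zhi 0]`
    (∀ u ∈ Icc (rw.ulo 0 j) (rw.uhi 0 j), ∀ r : Fin 4 → ℤ → ℝ,
      AbsLeW cd r (fun i k => bx.J j (cd.S j - 1) i k * u ^ (cd.pdeg + 1)) →
        InBox cd (rw.zlo 0 j) (rw.zhi 0 j) (cd.TP j (cd.S j - 1) u + r))


/-- **The v3 certificate predicate with Poincaré-corrected base landing.** [folklore] -/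
def ValidVP (cd : CertData) (bx : StepBoxes) (rd : RadiiData) (ro : ReadoutData) (rw : WinData) : Prop :=
  cd.Static ∧ cd.StageNumerics ∧ ChainV cd bx rd ∧ ReadoutsVP cd bx rd ro rw

end Summit.NavierStokesRegularity.NavierStokesRegularity.Theorems.TaylorModelV

end
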